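import Summits.Ventures.QEC.Census.CertCoverBatch
import Summits.Ventures.QEC.Census.BB.A1s_n168_k6_b9f9b93c.CoreDefs
import HarnessLib

set_option Elab.async false
set_option maxRecDepth 200000

/-!
# `[[168,6,16]]` one-level cover certificate of `A1s_n168_k6_b9f9b93c` — LEVEL-1→0 coset problems 226…246 (deep problems [24] excluded: `ProbDeep*.lean`) as COMPACT data
(`ProbData`: U, f, σ, y₀, allow; qec-type-10 `CertCoverBatch.mkCoset` rebuilds each `CosetProb` in the kernel) + their verdict
`probsOK cov covR hx hx1 D1 lxd 14` (one `decide +kernel`; 21 problems, depths f=0:21 f=1:0 f=2:0 f=3:0, est. 73.5 s).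
qec-search-1 g5 (pattern of search-9 g5 `Probs*`); data from JSON `level10.problems` (sha256 76451796c489f4a4…). Data + decided check; KERNEL.
-/

namespace Summit.Ventures.QEC.Census.A1s_n168_k6_b9f9b93c

open Matrix Summit.Ventures.QEC.Census Literature.InformationTheory.QuantumCodes

/-- Problems 226…246 (21): `⟨U, f, σ, y₀, allow⟩`. -/
def probs05 : List ProbData := [
    ⟨12111296433918377461761, 0, 481104625729, 304947737969273968798, []⟩,
    ⟨12557920519752033243648, 0, 2341831966726, 2508766203422777016832, [0]⟩,
    ⟨12996316676959504697472, 0, 279177203715, 12986507836963037714570, []⟩,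
    ⟨13018816656033506926850, 0, 2211910262784, 3574065675878698137642, []⟩,
    ⟨14180966115493212602385, 0, 2214095519744, 4722393513332226277393, []⟩,
    ⟨14251280874820364927498, 0, 558413448208, 14176322962485516978848, []⟩,
    ⟨14254888124954246660288, 0, 2278484350976, 4634212812683247622, []⟩,
    ⟨18972507820400912122896, 0, 15039725608, 9241399630586189074, []⟩,
    ⟨18977395339801831409920, 0, 2345590587405, 18977376199503412988160, [0]⟩,
    ⟨19046628188893856464960, 0, 174013513920, 288371182359543808, [0]⟩,
    ⟨20160291691922183997440, 0, 3444572160005, 20084180840627434424320, [0]⟩,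
    ⟨20227161156781617547264, 0, 146045665309, 18014398545133568, [0]⟩,
    ⟨21260467161122180567168, 0, 283535085641, 21250649313926324617354, []⟩,
    ⟨28509506047374098726914, 0, 30079582208, 18907921695945693331456, []⟩,
    ⟨33090585853697682571266, 0, 3028086423684, 9453965626450560227370, []⟩,
    ⟨37936458911736498618592, 0, 347959591296, 37779085126082786099392, [0]⟩,
    ⟨40153986367578479632416, 0, 2216287207432, 40140115245129489457152, [0]⟩,
    ⟨47292921469639212400710, 0, 2237814276112, 37834281106775893610496, []⟩,
    ⟨56830097291794467262465, 0, 2337538114640, 18894368099810899691636, []⟩,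
    ⟨114528371559517533650944, 0, 839699693576, 75568834494675320655880, []⟩,
    ⟨155257618258513588389912, 0, 284558361600, 151125547586001072887984, []⟩]

set_option maxHeartbeats 400000000 in
/-- Every problem of this chunk passes (`mkCoset` elimination + `cosetOKD` + fast `σ` + depth + `BU`-evenness + label checks). -/
theorem probs05_ok : probsOK A1s_n168_k6_b9f9b93c.cov covR hx hx1 D1 lxd 14 probs05 = true := by
  decide +kernel

/-- Pointwise form. -/
theorem probs05_all : ∀ x ∈ A1s_n168_k6_b9f9b93c.probs05, probOK cov covR hx hx1 D1 lxd 14 x = true := by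
  have h := probs05_ok
  rwa [probsOK, List.all_eq_true] at h

end Summit.Ventures.QEC.Census.A1s_n168_k6_b9f9b93c
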